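import Summits.HodgeConjecture.HodgeConjecture.Theses.HeckePrymWeil
import Summits.HodgeConjecture.HodgeConjecture.Theorems.HeckePrymWeilHeckePrymAnchorsOfStubs
import Summits.HodgeConjecture.HodgeConjecture.Theorems.HeckePrymWeilHeckePrymAnchorsUpgrade
import Summits.HodgeConjecture.HodgeConjecture.Theorems.HeckePrymWeilHeckePrymAnchorsRationalAlongSection
import Summits.HodgeConjecture.HodgeConjecture.Theorems.HeckePrymWeilHyperbolicEightfoldsSqrtMinus7LerayFact
import Summits.HodgeConjecture.HodgeConjecture.Theorems.HeckePrymWeilHyperbolicEightfoldsSqrtMinus7OfAnchorObject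
import Literature.AlgebraicGeometry.HodgeTheory.WeilFamilyReach
import Literature.AlgebraicGeometry.HodgeTheory.SemiregularVariationalHodgeFull
import Literature.AlgebraicGeometry.HodgeTheory.StandardChernCharacterBetti
import Literature.AlgebraicGeometry.HodgeTheory.WeilClassesSixfoldsProofs
import Literature.AlgebraicGeometry.HodgeTheory.WeilTypePeriodPoint
import Literature.AlgebraicGeometry.HodgeTheory.LefschetzOneOneHolds
import Literature.AlgebraicGeometry.HodgeTheory.AlgebraicClassesCupAbelianVariety
import Literature.AlgebraicGeometry.HodgeTheory.HodgeTypeExteriorProduct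
import Literature.AlgebraicGeometry.HodgeTheory.HodgeTypeConjugation
import Literature.AlgebraicGeometry.HodgeTheory.CorrespondenceCupProductIdentities
import Literature.AlgebraicGeometry.HodgeTheory.HardLefschetzThreefold
import Literature.AlgebraicGeometry.HodgeTheory.HodgeClassOfMorphismProofs
import Literature.AlgebraicGeometry.HodgeTheory.ComplexConjugationHolds
import Literature.AlgebraicGeometry.HodgeTheory.IsoTransport
import Literature.AlgebraicGeometry.Motives.AbelianVarietyCohomologyExteriorH1
import Literature.AlgebraicGeometry.Motives.VarietiesGeometricallyIntegralProofs
import HarnessLib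

/-!
# The Perry engine on a BRAUER–SEVERI FAMILY over Deligne's Weil family (engine step of the v4 composition)
# (crux `HeckePrymWeil.HyperbolicEightfoldsSqrtMinus7`, item stmt-HodgeConjecture-14642, route HeckePrymWeil)

Line `euler-squeeze-rank-two-secant-bundle`, skeleton v4 (lead c12, 2026-08-17): the composition of the line with the
object stub placed where Markman's mechanism produces it.  Markman (arXiv:2502.03415, §7.5.2 Steps 1–5) deforms a
semiregular TWISTED sheaf `ℬ` on the abelian fibre by running the UNTWISTED Buchweitz–Flenner theorem for the honest
sheaf `Ẽ₀ = p₀^*ℬ ⊗ 𝒪_{ℙ(Q₀)}(1)` on the projective bundle `ℙ(Q₀) → M₀` (semiregular iff `ℬ` is, Step 4;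
`ch(Ẽ₀) = p^*κ(ℬ)·exp(c₁(Ẽ₀)/r)` Hodge along the family, Steps 2–3), the projective bundle being extended over a
neighbourhood of the moduli point by Lemma 7.5.1.  Accordingly the anchor object is here a finite locally free fully
semiregular sheaf on the fibre `𝒬_{u₀}` of a smooth projective family `π : 𝒬 → U` mapping fibrewise onto an étale-type
neighbourhood `g : U → S` of the anchor point in Deligne's Weil family `f : 𝒳 → S`, with Chern character a polynomial in
`p₀^*h`, a global class `Λ` and `p₀^*w ∪ Λʲ`, CHARGED (hypothesis `hO`, at `(4, 7)` verbatim the registered stub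
`stub_anchorObjectBS` of the skeleton).  Nothing is asserted: the six hypotheses are the six other registered stubs —

1. `hO` — the anchor object on the Brauer–Severi family (the bet);
2. `HodgeTheory.weilFamilyReach_hyperbolic` (named fact F): Deligne's polarized Weil family through a hyperbolic anchor with
   relative polarization class, flat Weil section and reach of every hyperbolic target up to `K`-isogeny;
3. `HodgeTheory.Perry2026_semiregularFull_remainsAlgebraic` (named fact P, `[claim]`), applied to the Brauer–Severi family `π`;
4. `Nonempty HodgeTheory.StandardChernCharacterBetti` (construction debt C);
5. `hK` — algebraicity of a global class spreads from a non-empty Zariski-open set of fibres to all fibres (registered stub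
   `stub_spread`; tree-provable from `charlesSchnell_algebraicityLocus_iUnion_closed_holds` and Baire);
6. `hD` — Gysin descent of algebraicity along the projective-bundle fibres (registered stub `stub_gysinDescent`;
   tree-provable from `complexGysin_cup`).

Conclusion (`weilClasses_algebraic_of_anchorObjectBS`, every `n, d ≥ 1`): the strong Weil plane of EVERY hyperbolic
`(A, φ, h(e_A, a_A))` of dimension `2n` with `φ ≫ φ = -d` is algebraic; at `(4, 7)`
(`hyperbolicEightfoldsSqrtMinus7_of_anchorObjectBS`) the crux BY NAME.  MECHANISM: F carries `h(e, a)` as `H` and `w` as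
the section `σ`, globalised to `W ∈ H^{2n}(𝒳)` by the landed W-engine and rational along `σ`; `hO` applied to this family
gives `(U, 𝒬, g, π, p, Λ, Ẽ₀)`; `engine_of_perry_BS` (proved here) feeds P the sections
`u ↦ (Σ c_{kij} p^*Hⁱ ∪ Λʲ + [n ≤ k] r_{k-n} p^*W ∪ Λ^{k-n})|_{𝒬_u}` — continuous because global, Hodge-valued, `= ch(Ẽ₀)`
at `u₀` — so the degree-`(n+m)` class is algebraic on every `𝒬_u`; `hD` along `𝒬_u → 𝒳_{g(u)}` (an abelian fibre: the
divisor class `H` moves by translation, Kleiman) makes `W|_{𝒳_{g(u)}}` algebraic for every `u`, hence for every fibre over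
the Zariski-open `V ⊆ g(U)`; `hK` spreads to all fibres, in particular to the reached one `A' ≅ 𝒳_{s₁}`; ONE CLASS SUFFICES
(unconditional) and isogeny transfer (landed) return to `A`.  Hyperbolicity is consumed twice, as the crux's Disproof §3(e)
demands.  The v3 composition with the object on the abelian fibre itself remains `…OfAnchorObject` (p139316).
-/

noncomputable section

-- single-problem summit (Problem = Summit): the mandated namespace repeats `HodgeConjecture`.
set_option linter.dupNamespace false

open CategoryTheory AlgebraicGeometry Limits MonoidalCategory CartesianMonoidalCategory
open Literature.AlgebraicGeometry Literature.AlgebraicGeometry.Motives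
  Literature.AlgebraicGeometry.HodgeTheory
open Literature.AlgebraicTopology.SingularHomology
open Literature.NumberTheory.Transcendental (exists_deRhamIsoFamily_holds)
open Summit.HodgeConjecture.HodgeConjecture.Theorems.HeckePrymWeilLine
  (stub_upgrade stub_rationalAlongSection stub_isogenyTransfer owf_isoTransport)
open Summit.HodgeConjecture.HodgeConjecture.Theorems.HyperbolicEightfoldsSqrtMinus7.TensorAnchor
  (stub_globalClassEngine)
open Summit.HodgeConjecture.HodgeConjecture.Theorems.HyperbolicEightfoldsSqrtMinus7.AnchorObject
  (complexBetti_map_cupPowTwo cupPowTwo_mem_algebraicClasses_abelian)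

namespace Summit.HodgeConjecture.HodgeConjecture.Theorems.HyperbolicEightfoldsSqrtMinus7.AnchorObjectBS

/-! ## Infrastructure: rational / Hodge bookkeeping for the sections on the Brauer–Severi fibres -/

/-- A `dite` of rational classes is rational. [cite: HatcherAT2002, §3.1] -/
theorem isRationalClass_dite {Y : Type} [TopologicalSpace Y] {k : ℕ} {P : Prop} [Decidable P]
    {a : P → singularCohomology ℂ ℂ Y k} {b : ¬P → singularCohomology ℂ ℂ Y k}
    (ha : ∀ h, IsRationalClass (a h)) (hb : ∀ h, IsRationalClass (b h)) : IsRationalClass (dite P a b) := by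
  split_ifs with h
  · exact ha h
  · exact hb h

/-- A `dite` of classes of type `(p, q)` is of type `(p, q)`. [cite: VoisinHodgeI2002, §7.1.1] -/
theorem isOfHodgeType_dite {n : ℕ} {X : SchemeOver ℂ} {k p q : ℕ} {P : Prop} [Decidable P]
    {a : P → complexBetti X k} {b : ¬P → complexBetti X k}
    (ha : ∀ h, IsOfHodgeType n X k p q (a h)) (hb : ∀ h, IsOfHodgeType n X k p q (b h)) :
    IsOfHodgeType n X k p q (dite P a b) := by
  split_ifs with h
  · exact ha h
  · exact hb h

/-- `g^*(f^* x) = pu^*(ι^* x)` on classes, from a commuting square `pu ≫ ι = g ≫ f` of schemes.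
[cite: FultonYoungTableaux1997, Appendix B §B.1 (1)] -/
theorem map_map_eq_of_comm_sq {A B C D : SchemeOver ℂ} {g : A ⟶ B} {f : B ⟶ D} {pu : A ⟶ C} {ι : C ⟶ D}
    (hsq : pu ≫ ι = g ≫ f) (k : ℕ) (x : complexBetti D k) :
    complexBetti.map g k (complexBetti.map f k x) = complexBetti.map pu k (complexBetti.map ι k x) := by
  rw [← complexBetti.map_comp_apply', ← complexBetti.map_comp_apply', hsq]

/-- Re-indexing a cup power inside a cup product along an equality of exponents (the degree cast travels along).
[cite: HatcherAT2002, §3.2] -/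
theorem cupProduct_cupPowTwo_congr {X : SchemeOver ℂ} {p s : ℕ} (x : complexBetti X p) (Λ : complexBetti X 2)
    {j j' : ℕ} (hj : j = j') (h : p + 2 * j = s) (h' : p + 2 * j' = s) :
    cupProduct h x (cupPowTwo Λ j) = cupProduct h' x (cupPowTwo Λ j') := by
  subst hj
  rfl

/-! ## The engine step on the Brauer–Severi family, PROVED from Perry's fact -/

/-- **ENGINE (Perry on the Brauer–Severi family ⟹ the charged class is algebraic on EVERY fibre `𝒬_u`).**  Along a smooth
projective family `π : 𝒬 → U` of relative dimension `N` over a smooth irreducible quasi-projective base, mapping by `p` to a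
family `f : 𝒳 → S` over `g`, let `H ∈ H²(𝒳)` and `Λ ∈ H²(𝒬)` have rational `(1,1)` restrictions and `W ∈ H^{2n}(𝒳)` rational
`(n,n)` restrictions.  If at ONE point `u₀` a finite locally free SEMIREGULAR `E₀` on `𝒬_{u₀}` has
`ch_k(E₀) = (Σ_{i+j=k} c_{kij} p^*Hⁱ ∪ Λʲ + [n ≤ k] r_{k-n} p^*W ∪ Λ^{k-n})|_{𝒬_{u₀}}` in some Chern character theory `C`, then
for EVERY `u` and every `k` the restriction of that global class to `𝒬_u` is algebraic: Perry's theorem for the family of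
sections given by restriction of GLOBAL classes (continuous: `continuous_globalSection`; Hodge-valued: pull-backs, cup
powers and cup products of rational Hodge classes, `CupPreservesHodgeType` being unconditional in the tree).
[cite: Perry2026Semiregularity, Thm. 1.1 (2)] [cite: Markman2025SecantWeil, §7.5.2 Steps 3–5]
[cite: BuchweitzFlenner2003, Thm. 5.1] -/
theorem engine_of_perry_BS :
    ∀ (hP : Perry2026_semiregularFull_remainsAlgebraic) (n N : ℕ)
    {𝒳 S U 𝒬 : SchemeOver ℂ} (f : 𝒳 ⟶ S) (g : U ⟶ S) (π : 𝒬 ⟶ U) (p : 𝒬 ⟶ 𝒳)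
    (hXfam : IsSmoothProjectiveFamily f (2 * n)) (hπ : IsSmoothProjectiveFamily π N)
    (hUirr : IrreducibleSpace U.left) (hUsm : AlgebraicGeometry.Smooth U.hom) (hUqp : IsQuasiProjectiveOver U)
    (pu : ∀ u : ComplexPoints U, fiberOver π u ⟶ fiberOver f (u ≫ g))
    (hpu : ∀ u, pu u ≫ fiberι f (u ≫ g) = fiberι π u ≫ p)
    (H : complexBetti 𝒳 2)
    (hH : ∀ s, IsRationalClass (complexBetti.map (fiberι f s) 2 H) ∧
      IsOfHodgeType (2 * n) (fiberOver f s) 2 1 1 (complexBetti.map (fiberι f s) 2 H))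
    (W : complexBetti 𝒳 (2 * n))
    (hWrat : ∀ s, IsRationalClass (complexBetti.map (fiberι f s) (2 * n) W))
    (hWH : ∀ s, IsOfHodgeType (2 * n) (fiberOver f s) (2 * n) n n (complexBetti.map (fiberι f s) (2 * n) W))
    (Λ : complexBetti 𝒬 2)
    (hΛ : ∀ u, IsRationalClass (complexBetti.map (fiberι π u) 2 Λ) ∧
      IsOfHodgeType N (fiberOver π u) 2 1 1 (complexBetti.map (fiberι π u) 2 Λ))
    (c : ℕ → ℕ → ℕ → ℚ) (r : ℕ → ℚ)
    (u₀ : ComplexPoints U) (C : ChernCharacterBetti) (E₀ : (fiberOver π u₀).left.Modules)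
    (hE₀ : IsFiniteLocallyFree E₀) (hsr : IsISemiregular hE₀ Set.univ)
    (hch : ∀ k : ℕ, C.ch (fiberOver π u₀) E₀ k =
      (∑ i ∈ Finset.range (k + 1), ∑ j ∈ Finset.range (k + 1),
        if hij : i + j = k then
          ((c k i j : ℚ) : ℂ) • cupProduct (show 2 * i + 2 * j = 2 * k by omega)
            (complexBetti.map (fiberι π u₀) (2 * i) (complexBetti.map p (2 * i) (cupPowTwo H i)))
            (cupPowTwo (complexBetti.map (fiberι π u₀) 2 Λ) j)
        else 0) +
      (if hk : n ≤ k then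
          ((r (k - n) : ℚ) : ℂ) • cupProduct (show 2 * n + 2 * (k - n) = 2 * k by omega)
            (complexBetti.map (fiberι π u₀) (2 * n) (complexBetti.map p (2 * n) W))
            (cupPowTwo (complexBetti.map (fiberι π u₀) 2 Λ) (k - n))
        else 0)),
    ∀ (u : ComplexPoints U) (k : ℕ),
      (∑ i ∈ Finset.range (k + 1), ∑ j ∈ Finset.range (k + 1),
        if hij : i + j = k then
          ((c k i j : ℚ) : ℂ) • cupProduct (show 2 * i + 2 * j = 2 * k by omega)
            (complexBetti.map (fiberι π u) (2 * i) (complexBetti.map p (2 * i) (cupPowTwo H i)))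
            (cupPowTwo (complexBetti.map (fiberι π u) 2 Λ) j)
        else 0) +
      (if hk : n ≤ k then
          ((r (k - n) : ℚ) : ℂ) • cupProduct (show 2 * n + 2 * (k - n) = 2 * k by omega)
            (complexBetti.map (fiberι π u) (2 * n) (complexBetti.map p (2 * n) W))
            (cupPowTwo (complexBetti.map (fiberι π u) 2 Λ) (k - n))
        else 0) ∈ algebraicClasses (fiberOver π u) k := by
  intro hP n N 𝒳 S U 𝒬 f g π p hXfam hπ hUirr hUsm hUqp pu hpu H hH W hWrat hWH Λ hΛ c r u₀ C E₀ hE₀ hsr hch u k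
  haveI := hUsm
  haveI := hUirr
  haveI : IsReduced U.left := isReduced_of_smooth_over_field U.hom
  have hint : IsIntegral U.left := isIntegral_of_irreducibleSpace_of_isReduced _
  -- the global classes on the total space `𝒬`
  let G : ∀ k : ℕ, complexBetti 𝒬 (2 * k) := fun k =>
    (∑ i ∈ Finset.range (k + 1), ∑ j ∈ Finset.range (k + 1),
      if hij : i + j = k then
        ((c k i j : ℚ) : ℂ) • cupProduct (show 2 * i + 2 * j = 2 * k by omega)
          (complexBetti.map p (2 * i) (cupPowTwo H i)) (cupPowTwo Λ j)
      else 0) +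
    (if hk : n ≤ k then
        ((r (k - n) : ℚ) : ℂ) • cupProduct (show 2 * n + 2 * (k - n) = 2 * k by omega)
          (complexBetti.map p (2 * n) W) (cupPowTwo Λ (k - n))
      else 0)
  -- their restrictions to the fibres
  have hres : ∀ (k : ℕ) (v : ComplexPoints U), complexBetti.map (fiberι π v) (2 * k) (G k) =
      (∑ i ∈ Finset.range (k + 1), ∑ j ∈ Finset.range (k + 1),
        if hij : i + j = k then
          ((c k i j : ℚ) : ℂ) • cupProduct (show 2 * i + 2 * j = 2 * k by omega)
            (complexBetti.map (fiberι π v) (2 * i) (complexBetti.map p (2 * i) (cupPowTwo H i)))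
            (cupPowTwo (complexBetti.map (fiberι π v) 2 Λ) j)
        else 0) +
      (if hk : n ≤ k then
          ((r (k - n) : ℚ) : ℂ) • cupProduct (show 2 * n + 2 * (k - n) = 2 * k by omega)
            (complexBetti.map (fiberι π v) (2 * n) (complexBetti.map p (2 * n) W))
            (cupPowTwo (complexBetti.map (fiberι π v) 2 Λ) (k - n))
        else 0) := by
    intro k v
    simp only [G, map_add, map_sum]
    congr 1
    · refine Finset.sum_congr rfl fun i _ => Finset.sum_congr rfl fun j _ => ?_
      split_ifs with hij
      · rw [map_smul, complexBetti.map_cupProduct, complexBetti_map_cupPowTwo (fiberι π v) Λ j]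
      · rw [map_zero]
    · split_ifs with hk
      · rw [map_smul, complexBetti.map_cupProduct, complexBetti_map_cupPowTwo (fiberι π v) Λ (k - n)]
      · rw [map_zero]
  -- the family of sections
  let w : ∀ (k : ℕ) (v : ComplexPoints U), complexBetti (fiberOver π v) (2 * k) :=
    fun k v => complexBetti.map (fiberι π v) (2 * k) (G k)
  have hwc : ∀ k, Continuous fun v => (⟨v, w k v⟩ : FiberClass π (2 * k)) := fun k =>
    continuous_globalSection π (2 * k) (G k)
  -- Hodge bookkeeping on a fibre `𝒬_v`
  have hHi : ∀ (v : ComplexPoints U) (i : ℕ),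
      IsRationalClass (complexBetti.map (fiberι π v) (2 * i) (complexBetti.map p (2 * i) (cupPowTwo H i))) ∧
      IsOfHodgeType N (fiberOver π v) (2 * i) i i
        (complexBetti.map (fiberι π v) (2 * i) (complexBetti.map p (2 * i) (cupPowTwo H i))) := by
    intro v i
    rw [map_map_eq_of_comm_sq (hpu v), complexBetti_map_cupPowTwo, complexBetti_map_cupPowTwo]
    exact ⟨((hH _).1.map _).cupPowTwo i,
      isOfHodgeType_cupPowTwo (hπ.isSmoothProjective v)
        ((hH _).2.map_of_isSmoothProjective (hπ.isSmoothProjective v) (hXfam.isSmoothProjective _) (pu v)) i⟩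
  have hWv : ∀ v : ComplexPoints U,
      IsRationalClass (complexBetti.map (fiberι π v) (2 * n) (complexBetti.map p (2 * n) W)) ∧
      IsOfHodgeType N (fiberOver π v) (2 * n) n n
        (complexBetti.map (fiberι π v) (2 * n) (complexBetti.map p (2 * n) W)) := by
    intro v
    rw [map_map_eq_of_comm_sq (hpu v)]
    exact ⟨(hWrat _).map _,
      (hWH _).map_of_isSmoothProjective (hπ.isSmoothProjective v) (hXfam.isSmoothProjective _) (pu v)⟩
  have hΛj : ∀ (v : ComplexPoints U) (j : ℕ), IsRationalClass (cupPowTwo (complexBetti.map (fiberι π v) 2 Λ) j) ∧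
      IsOfHodgeType N (fiberOver π v) (2 * j) j j (cupPowTwo (complexBetti.map (fiberι π v) 2 Λ) j) := fun v j =>
    ⟨(hΛ v).1.cupPowTwo j, isOfHodgeType_cupPowTwo (hπ.isSmoothProjective v) (hΛ v).2 j⟩
  have hcup : ∀ v : ComplexPoints U, CupPreservesHodgeType N (fiberOver π v) := fun v =>
    cupPreservesHodgeType_of_multiplicative_deRham (fun E _ _ _ ↦ exists_deRhamIsoFamily_holds E)
      (hπ.isSmoothProjective v)
  have hwH : ∀ k v, (⟨v, w k v⟩ : FiberClass π (2 * k)) ∈ locusOfHodgeClasses π N k := by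
    intro k v
    rw [mem_locusOfHodgeClasses_iff]
    obtain ⟨M⟩ := nonempty_hodgeModel_holds.nonempty (hπ.isSmoothProjective v)
    show IsRationalClass (w k v) ∧ IsOfHodgeType N (fiberOver π v) (2 * k) k k (w k v)
    simp only [w, hres k v]
    refine ⟨?_, ?_⟩
    · refine (isRationalClass_sum _ _ fun i _ => isRationalClass_sum _ _ fun j _ =>
        isRationalClass_dite (fun hij => ?_) (fun _ => IsRationalClass.zero)).add
        (isRationalClass_dite (fun hk => ?_) (fun _ => IsRationalClass.zero))
      · exact ((hHi v i).1.cup _ (hΛj v j).1).smul _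
      · exact ((hWv v).1.cup _ (hΛj v (k - n)).1).smul _
    · refine (IsOfHodgeType.sum (hπ.isSmoothProjective v) M _ _ fun i _ =>
        IsOfHodgeType.sum (hπ.isSmoothProjective v) M _ _ fun j _ =>
          isOfHodgeType_dite (fun hij => ?_) (fun _ => IsOfHodgeType.zero M _ _ _)).add
        (hπ.isSmoothProjective v) (isOfHodgeType_dite (fun hk => ?_) (fun _ => IsOfHodgeType.zero M _ _ _))
      · have h := hcup v (show 2 * i + 2 * j = 2 * k by omega) (hHi v i).2 (hΛj v j).2
        rw [show i + j = k from hij] at h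
        exact h.smul _
      · have h := hcup v (show 2 * n + 2 * (k - n) = 2 * k by omega) (hWv v).2 (hΛj v (k - n)).2
        rw [show n + (k - n) = k by omega] at h
        exact h.smul _
  -- the values at `u₀` are the Chern character of `E₀`
  have hw₀ : ∀ k, w k u₀ = C.ch (fiberOver π u₀) E₀ k := by
    intro k
    show complexBetti.map (fiberι π u₀) (2 * k) (G k) = _
    rw [hres k u₀, hch k]
  -- Perry
  have h := hP C π N hπ hUqp hint hUsm w hwc hwH u₀ E₀ hE₀ hsr hw₀ u k
  have h' : w k u = _ := hres k u
  rwa [h'] at h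

end Summit.HodgeConjecture.HodgeConjecture.Theorems.HyperbolicEightfoldsSqrtMinus7.AnchorObjectBS

end
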